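import Literature.AlgebraicGeometry.HodgeTheory.QuaternionicQuarticDeckChartIntegral
import Literature.AlgebraicGeometry.HodgeTheory.QuaternionicQuarticDeckChartBaseChange
import Literature.AlgebraicGeometry.Resolution.ProjectiveSpaceRegular
import Literature.AlgebraicGeometry.RelativeSpec.ActionOverBaseChange
import HarnessLib

/-!
# The generic étale chart of the quaternionic quartic family: an affine, integral, regular, geometrically
# irreducible `K`-scheme of finite type with its `Q₈`-action (programme «M1», brick M1-0c)

Layer `Literature/AlgebraicGeometry/HodgeTheory`. Definitions + proved API (no named fact). Written by the prover
seat `hodge-nonav-prover-Bx` (g19, cell `hodge-nonav`), programme M1 (memo `PROGRAMME-M1-Bx-g19.md`) for route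
`HodgeConjecture/Q8SymplecticPowers` (crux K1Q, stmt-HodgeConjecture-24190).

With `A = ℂ[a]` (`ParamRing e`), `K` a fraction field of `A` and the universal chart
`𝒰 = deckChart X → Spec A` (`QuaternionicQuarticDeckChartAction`), the GENERIC CHART is the `K`-scheme
`genericChart e K := 𝒰 ×_A Spec K → Spec K` (the object `𝒰 ⊗ specOver A K` of `SchemeOver A`, viewed over `K`),
with the base-changed action `genericAction e K` of `Q₈` (whiskering `ρ(g) ▷ Spec K`). This file packages the inputs
of the equivariant projective completion (brick M1-2, `Resolution.exists_equivariant_projective_completion`) and of the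
lifting to the functorial resolution (brick M1-3):

* (base change of actions `ActionOver.tensorRight` is in `RelativeSpec/ActionOverBaseChange`);
* `genericChart`, `genericAction`; `isAffine_genericChart`, `locallyOfFiniteType_genericChart`;
* `isIntegral_genericChart` (`e ≥ 2`: the chart ring at the injective point `A ↪ K` is a domain,
  `isDomain_deckRing_of_injective`, through the base-change iso `deckChartTensorLeftIso`);
* `isRegular_genericChart` (`isRegularRing_deckRing`, `Scheme.isRegular_Spec`);
* `geometricallyIrreducible_genericChart` (every field point `A ↪ K → L` is injective, so every base change is
  the spectrum of a domain).

Honest scope: packaging; nothing here bears on HC.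

## References

* [SGA1] A. Grothendieck, SGA 1, Exp. V §1 (actions over a base and base change).
* [StacksProject] The Stacks Project, Tags 00UB, 00TV, 038F.
* [Kollar2007] J. Kollár, Lectures on Resolution of Singularities (2007), §3.3–3.4.
-/

noncomputable section

open CategoryTheory CategoryTheory.Limits AlgebraicGeometry MonoidalCategory CartesianMonoidalCategory MvPolynomial

universe u

/-! ### The generic chart -/

namespace Literature.AlgebraicGeometry.HodgeTheory.Q8Family

open Literature.AlgebraicGeometry.Motives Literature.AlgebraicGeometry.RelativeSpec

variable (e : ℕ) (K : Type) [Field K] [Algebra (ParamRing e) K]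

/-- The universal coefficient vector `X : CIdx e → A`. [cite: Kollar2007, §3.3] -/
abbrev univVec : CIdx e → ParamRing e := fun i => (X i : ParamRing e)

/-- **The universal étale chart `𝒰 → Spec A`** of the quaternionic quartic family. [cite: Kollar2007, §3.3] -/
abbrev univChart : SchemeOver (ParamRing e) := deckChart (univVec e)

attribute [local instance] baseAlgebra isScalarTower_base in
/-- **The chart is smooth of relative dimension `2` over any base**: `Spec (DeckRing a) → Spec R[u₀, u₁]` is étale
(`etale_deckRing`) and `Spec R[u₀, u₁] → Spec R` is smooth of relative dimension `2`.
[cite: StacksProject, Tag 00UB] [cite: Hartshorne1977, III §10 Example 10.0.1] -/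
theorem smoothOfRelativeDimension_deckChart {R : Type u} [CommRing R] [Algebra ℂ R] {e' : ℕ} (a : CIdx e' → R) :
    SmoothOfRelativeDimension 2 (deckChart a).hom := by
  have hfac : (deckChart a).hom =
      Spec.map (CommRingCat.ofHom (algebraMap (MvPolynomial (Fin 2) R) (DeckRing a))) ≫
        Spec.map (CommRingCat.ofHom (algebraMap R (MvPolynomial (Fin 2) R))) := by
    change Spec.map (CommRingCat.ofHom (algebraMap R (DeckRing a))) = _
    rw [← Spec.map_comp, ← CommRingCat.ofHom_comp, ← IsScalarTower.algebraMap_eq R (MvPolynomial (Fin 2) R)]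
  have h1 : Etale (Spec.map (CommRingCat.ofHom (algebraMap (MvPolynomial (Fin 2) R) (DeckRing a)))) := by
    rw [HasRingHomProperty.Spec_iff (P := @Etale), CommRingCat.hom_ofHom, RingHom.etale_algebraMap]
    exact etale_deckRing a
  have h2 : SmoothOfRelativeDimension 2 (Spec.map (CommRingCat.ofHom (algebraMap R (MvPolynomial (Fin 2) R)))) := by
    rw [HasRingHomProperty.Spec_iff (P := @SmoothOfRelativeDimension 2), CommRingCat.hom_ofHom]
    refine RingHom.locally_of RingHom.isStandardSmoothOfRelativeDimension_respectsIso _ ?_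
    rw [RingHom.isStandardSmoothOfRelativeDimension_algebraMap]
    exact Motives.ProjectiveSpace.isStandardSmoothOfRelativeDimension_mvPolynomial_fin R 2
  haveI := h1
  haveI := h2
  rw [hfac]
  have : SmoothOfRelativeDimension (0 + 2)
      (Spec.map (CommRingCat.ofHom (algebraMap (MvPolynomial (Fin 2) R) (DeckRing a))) ≫
        Spec.map (CommRingCat.ofHom (algebraMap R (MvPolynomial (Fin 2) R)))) := inferInstance
  rwa [Nat.zero_add] at this

/-- **The generic chart** `𝒰 ×_A Spec K → Spec K`. [cite: Kollar2007, §3.3] -/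
def genericChart : SchemeOver K := Over.mk (snd (univChart e) (specOver (ParamRing e) K)).left

/-- The underlying scheme of the generic chart is `(𝒰 ⊗ Spec K).left`. [cite: Kollar2007, §3.3] -/
theorem genericChart_left : (genericChart e K).left = (univChart e ⊗ specOver (ParamRing e) K).left := rfl

/-- The structure map of the generic chart is the second projection. [cite: Kollar2007, §3.3] -/
theorem genericChart_hom : (genericChart e K).hom = (snd (univChart e) (specOver (ParamRing e) K)).left := rfl

/-- **The action of `Q₈` on the generic chart** (base change of `deckAction`). [cite: Kollar2007, §3.4.1] -/
def genericAction : ActionOver (genericChart e K).hom (QuaternionGroup 2) :=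
  (deckAction (univVec e)).tensorRight (specOver (ParamRing e) K)

/-- The generic chart is `Spec` of the chart ring of the generic coefficient vector. [cite: GortzWedhorn2020, Prop. 4.18] -/
def genericChartIso :
    (genericChart e K).left ≅ Spec (CommRingCat.of (DeckRing (aφ (algebraMap (ParamRing e) K)))) :=
  deckChartTensorLeftIso K (univVec e)

/-- The generic chart is affine. [cite: GortzWedhorn2020, Prop. 4.18] -/
theorem isAffine_genericChart : IsAffine (genericChart e K).left :=
  IsAffine.of_isIso (genericChartIso e K).hom

/-- The generic chart is of finite type over `K`. [cite: GortzWedhorn2020, Prop. 4.18] -/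
theorem locallyOfFiniteType_genericChart : LocallyOfFiniteType (genericChart e K).hom := by
  rw [genericChart_hom]
  change LocallyOfFiniteType (pullback.snd (univChart e).hom (specOver (ParamRing e) K).hom)
  haveI : LocallyOfFiniteType (univChart e).hom := by
    change LocallyOfFiniteType (Spec.map (CommRingCat.ofHom (algebraMap (ParamRing e) (DeckRing (univVec e)))))
    rw [HasRingHomProperty.Spec_iff (P := @LocallyOfFiniteType)]
    exact RingHom.finiteType_algebraMap.mpr inferInstance
  infer_instance

variable [Algebra ℂ K]

omit [Algebra ℂ K] in
/-- **The generic chart is smooth of relative dimension `2` over `K`** (base change of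
`smoothOfRelativeDimension_deckChart`). [cite: Hartshorne1977, III Prop. 10.1 (b)] -/
theorem smoothOfRelativeDimension_genericChart : SmoothOfRelativeDimension 2 (genericChart e K).hom := by
  rw [genericChart_hom]
  change SmoothOfRelativeDimension 2 (pullback.snd (univChart e).hom (specOver (ParamRing e) K).hom)
  haveI := smoothOfRelativeDimension_isStableUnderBaseChange (n := 2)
  exact MorphismProperty.pullback_snd (P := @SmoothOfRelativeDimension 2) _ _
    (smoothOfRelativeDimension_deckChart (univVec e))

/-- **The generic chart is regular** (étale over `K[u₀, u₁]`). [cite: StacksProject, Tag 00TV] -/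
theorem isRegular_genericChart : Resolution.Scheme.IsRegular (genericChart e K).left := by
  haveI : IsRegularRing (CommRingCat.of (DeckRing (aφ (algebraMap (ParamRing e) K)))) :=
    isRegularRing_deckRing _
  have h := Resolution.Scheme.isRegular_Spec (CommRingCat.of (DeckRing (aφ (algebraMap (ParamRing e) K))))
  intro x
  haveI := h ((genericChartIso e K).hom x)
  exact IsRegularLocalRing.of_ringEquiv (asIso ((genericChartIso e K).hom.stalkMap x)).commRingCatIsoToRingEquiv

variable [IsFractionRing (ParamRing e) K]

/-- **The generic chart is integral** (`e ≥ 2`): its ring is the chart ring at the injective point `A ↪ K`, a domain.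
[cite: StacksProject, Tag 00UB] -/
theorem isIntegral_genericChart (he : 2 ≤ e) : IsIntegral (genericChart e K).left := by
  haveI : IsDomain (DeckRing (aφ (algebraMap (ParamRing e) K))) :=
    isDomain_deckRing_of_injective (algebraMap (ParamRing e) K) (IsFractionRing.injective (ParamRing e) K) he
  haveI : IsIntegral (Spec (CommRingCat.of (DeckRing (aφ (algebraMap (ParamRing e) K))))) := inferInstance
  exact IsIntegral.of_isIso (genericChartIso e K).inv

/-- **The generic chart is geometrically irreducible**: over every field point `Spec L → Spec K` its base change is
the chart of the coefficient vector at the injective point `A ↪ K → L`, the spectrum of a domain (`e ≥ 2`).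
[cite: StacksProject, Tag 038F] -/
theorem geometricallyIrreducible_genericChart (he : 2 ≤ e) : GeometricallyIrreducible (genericChart e K).hom := by
  rw [GeometricallyIrreducible.eq_geometrically, genericChart_hom]
  change geometrically _ (pullback.snd (univChart e).hom (Spec.map (CommRingCat.ofHom (algebraMap (ParamRing e) K))))
  rw [geometrically_iff_of_commRing_of_isClosedUnderIsomorphisms]
  intro L _ _
  letI : Algebra (ParamRing e) L := ((algebraMap K L).comp (algebraMap (ParamRing e) K)).toAlgebra
  haveI : IsScalarTower (ParamRing e) K L := IsScalarTower.of_algebraMap_eq fun _ => rfl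
  letI : Algebra ℂ L := ((algebraMap K L).comp (algebraMap ℂ K)).toAlgebra
  -- the base change is `𝒰 ×_A Spec L`
  have hfac : Spec.map (CommRingCat.ofHom (algebraMap K L)) ≫
      Spec.map (CommRingCat.ofHom (algebraMap (ParamRing e) K)) =
      Spec.map (CommRingCat.ofHom (algebraMap (ParamRing e) L)) := by
    rw [← Spec.map_comp, ← CommRingCat.ofHom_comp]
  let c : pullback (pullback.snd (univChart e).hom (Spec.map (CommRingCat.ofHom (algebraMap (ParamRing e) K))))
      (Spec.map (CommRingCat.ofHom (algebraMap K L))) ≅ (univChart e ⊗ specOver (ParamRing e) L).left :=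
    pullbackLeftPullbackSndIso _ _ _ ≪≫ pullback.congrHom rfl hfac
  have hinj : Function.Injective (algebraMap (ParamRing e) L) :=
    (algebraMap K L).injective.comp (IsFractionRing.injective (ParamRing e) K)
  haveI : IsDomain (DeckRing (⇑(algebraMap (ParamRing e) L) ∘ univVec e)) :=
    isDomain_deckRing_of_injective (algebraMap (ParamRing e) L) hinj he
  haveI : IsIntegral (Spec (CommRingCat.of (DeckRing (⇑(algebraMap (ParamRing e) L) ∘ univVec e)))) :=
    inferInstance
  haveI : IsIntegral (univChart e ⊗ specOver (ParamRing e) L).left :=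
    IsIntegral.of_isIso (deckChartTensorLeftIso L (univVec e)).inv
  haveI : IsIntegral (pullback (pullback.snd (univChart e).hom (Spec.map (CommRingCat.ofHom (algebraMap (ParamRing e) K))))
      (Spec.map (CommRingCat.ofHom (algebraMap K L)))) := IsIntegral.of_isIso c.inv
  infer_instance

end Literature.AlgebraicGeometry.HodgeTheory.Q8Family

end
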